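import Summits.HodgeConjecture.HodgeConjecture.Theorems.R90S4CubicCartanStableClass         -- ★ p863813 (this seat): the `Gqs` frame — `IsStablyConjGAt`, `splitFormGL`, `Gqs`, ★ Weil1982 letters, ★ `QuadraticLocalNormGroupNonsplit`
import Literature.NumberTheory.Rogawski1990.LocalStableClassesNonsplitTypeTwoCount              -- ★ B-p14: `exists_isStablyConj_not_isConj_and_forall` (type (2): the stable class has exactly two classes), `ncard_conjClassesIn_eq_two`
import HarnessLib

/-!
# R90-TF · S4 «Ch. 13.1–2», (DICT) sub-brick (2), FILE 3 — THE TWO CLASSES OF A TYPE-(2) STABLE CLASS IN `Gqs` CURRENCY: for `γ ∈ Gqs L v` with a `(2,1)` block frame whose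
# `2 × 2` block has irreducible characteristic polynomial (`T ≅ T_K × E¹`), there is `γ₂ ∼_{st} γ`, `γ₂ ≁ γ`, and every `γ′ ∼_{st} γ` is conjugate to `γ` or to `γ₂` (Rogawski 1990, §3.6)

Cell `hodgecm-mathlib`, crux H413 (`stmt-HodgeConjecture-24833`, lane `--supports … --as helper`), route of record `HCCMUnconditional` (no route verbs; count-neutral).
Programme R90-TF, section S4, dealer K2E2-plan (g7): deal «(DICT)(2) `K¹ × E¹`: two classes, the second class, the transport» (`R90/STATUS.md` 2026-09-05T00:55:10Z, GO F1
01:12:40Z); seat K2E3-p27 (g3).  THEOREMS ONLY — no `def`, no instance, no notation, no `sorry`; ★-only imports.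

## THE MATHEMATICS
The class-set statement «`|𝔇(T∕F)| = 2` for `T = T_K × E¹`, with a named second class» is ★ in the tree in BLOCK-FRAME currency: ★
`Literature.NumberTheory.Rogawski1990.exists_isStablyConj_not_isConj_and_forall` (B-p14; for `γ ∈ U(H)(F_v)`, `H ∈ M₃(L ⊗ L⁺_v)` hermitian with unit determinant, `v` non-split,
`γP = P·[A 0; 0 u]` with `χ_A` irreducible).  This file is the thin export to the (B2-S) currency of S4: `Gqs L v = U(Φ₃)(L⁺_v)` (★ `cmLocalForm L 3 v`, conjugation `c ⊗ 1`),
stable conjugacy `IsStablyConjGAt L (splitFormGL L) v` (= conjugacy in `GL₃(L ⊗ L⁺_v)`, ★ p863391) and conjugacy `IsConj` in the group `Gqs L v`: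
**`exists_stableClass_two_of_blockFrame`**.  (An independent route through the idempotent letter of `Z(γ)` — corner field, four norm classes — is ★ FILE 2a/2b
`R90S4TypeTwoCornerField` ∕ `R90S4TypeTwoNormClassesCover` + ★ FILE 1 `R90S4StableConjTwoClassesOfNormClassesFour`.)

## CONTENTS
* §1 **`exists_stableClass_two_of_blockFrame`** — `∃ γ₂, γ ∼_{st} γ₂ ∧ ¬ IsConj γ γ₂ ∧ ∀ γ′, γ ∼_{st} γ′ → IsConj γ γ′ ∨ IsConj γ₂ γ′`.

HONEST LABEL: HC_CM is proved only modulo the 7 printed citations (2 remaining named inputs: hLiu418 = stmt-HodgeConjecture-24832, h413 = stmt-HodgeConjecture-24833) until rung 0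
closes.  Local algebra toward the (DICT) payer of (B2-S); discharges no named input; (W-NP) ∕ (B2-S) OPEN.  REL ≠ ★ ≠ BUILT.

## References
* [Rogawski1990] J. D. Rogawski, *Automorphic Representations of Unitary Groups in Three Variables*, Ann. of Math. Stud. 123 (1990), §3.5 Prop. 3.5.2 (c) p. 29, §3.6 p. 31.
* [Kottwitz1986] R. E. Kottwitz, *Stable trace formula: elliptic singular terms*, Math. Ann. 275 (1986), §7.
-/

set_option autoImplicit false
set_option linter.dupNamespace false

noncomputable section

open NumberField IsDedekindDomain
open scoped Matrix MatrixGroups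
open Literature.NumberTheory.Rogawski1990 Literature.NumberTheory.Automorphic Literature.NumberTheory.Automorphic.UnitaryGroup
open Literature.AlgebraicGeometry.ShimuraVarieties (unitaryGroup mem_unitaryGroup_iff)
open Summit.HodgeConjecture.HodgeConjecture.Cruxes.H413

namespace Summit.HodgeConjecture.HodgeConjecture.R90.S4

section TypeTwo

variable (L : Type) [Field L] [NumberField L] [IsCMField L] (v : HeightOneSpectrum (𝓞 ↥(maximalRealSubfield L)))

variable {L v} in
/-- **THE TWO CLASSES OF A TYPE-(2) STABLE CLASS, `Gqs` CURRENCY.**  `v` non-split; `γ ∈ Gqs L v = U(Φ₃)(L⁺_v)` with a `(2,1)` block frame `γ·P = P·[A 0; 0 u]` over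
`L ⊗ L⁺_v`, `χ_A` irreducible (the type-(2) letter: `Z(γ) ≅ (L ⊗ L⁺_v)[A] × (L ⊗ L⁺_v)`, `T ≅ T_K × E¹`).  Then there is `γ₂ ∈ Gqs L v` stably conjugate (★ `IsStablyConjGAt`) and NOT
conjugate to `γ`, and every `γ′` stably conjugate to `γ` is conjugate in `Gqs L v` to `γ` or to `γ₂` — `|𝔇(T∕F)| = 2^{r−1} = 2` [§3.5 Prop. 3.5.2 (c), §3.6 type (2)].  Thin export
of ★ `exists_isStablyConj_not_isConj_and_forall` at `H := Φ₃ ⊗ 1` (★ `cmLocalForm L 3 v`), `σ := c ⊗ 1`. [cite: Rogawski1990, §3.5 Prop. 3.5.2 (c) p. 29; §3.6 p. 31]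
[cite: Kottwitz1986, §7] -/
theorem exists_stableClass_two_of_blockFrame (hns : ∀ w : PlacesOver L v, IsCMField.complexConj L • w.1 = w.1) {γ : Gqs L v} (e : Fin 2 ⊕ Fin 1 ≃ Fin 3)
    {P : GL (Fin 3) (LocalRing L v)} {A : Matrix (Fin 2) (Fin 2) (LocalRing L v)} {u : LocalRing L v}
    (hP : γ.val.val * P.val = P.val * Matrix.reindex e e (Matrix.fromBlocks A 0 0 !![u])) (hA : Irreducible A.charpoly) :
    ∃ γ₂ : Gqs L v, IsStablyConjGAt L (splitFormGL L) v γ γ₂ ∧ ¬ IsConj γ γ₂ ∧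
      ∀ γ' : Gqs L v, IsStablyConjGAt L (splitFormGL L) v γ γ' → IsConj γ γ' ∨ IsConj γ₂ γ' := by
  obtain ⟨w⟩ := (inferInstance : Nonempty (PlacesOver L v))
  have hw := hns w
  haveI : Algebra.IsQuadraticExtension ↥(maximalRealSubfield L) L := IsCMField.isQuadraticExtension L
  -- the letters of the quasi-split local form
  have hH : IsUnit (cmLocalForm L 3 v).det := by
    rw [cmLocalForm_eq_over]
    exact (Matrix.isUnit_iff_isUnit_det _).1 ((StdForm.antidiagonal 3).isUnit_over _)
  have hHh : ((cmLocalForm L 3 v).map (conjLocal L (IsCMField.complexConj L) v))ᵀ = cmLocalForm L 3 v := by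
    rw [cmLocalForm_eq_over, StdForm.over_map, StdForm.transpose_over]
  obtain ⟨δ, hcδ, hδ⟩ := Literature.NumberTheory.Weil1982.UnitaryFinTopForm.exists_complexConj_eq_neg_ne_zero L
  -- the two renderings of `U(Φ₃)(L⁺_v)`
  have hUU : unitaryGroupOfForm (conjLocal L (IsCMField.complexConj L) v) (cmLocalForm L 3 v) =
      unitaryGroup (conjLocal L (IsCMField.complexConj L) v) (cmLocalForm L 3 v) := Subgroup.ext fun _ => Iff.rfl
  have hγU : γ.val ∈ unitaryGroup (conjLocal L (IsCMField.complexConj L) v) (cmLocalForm L 3 v) := by rw [← hUU]; exact γ.2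
  -- ★ B-p14: the stable class of `γ` in `U(Φ₃)` has exactly two classes
  obtain ⟨δ₀, hst, hnc, hall⟩ :=
    exists_isStablyConj_not_isConj_and_forall L v (IsCMField.complexConj L) hcδ hδ e w hw hHh hH hγU hP hA
  have hδ₀U : (δ₀ : GL (Fin 3) (LocalRing L v)) ∈ unitaryGroupOfForm (conjLocal L (IsCMField.complexConj L) v) (cmLocalForm L 3 v) := by
    rw [hUU]; exact δ₀.2
  refine ⟨⟨(δ₀ : GL (Fin 3) (LocalRing L v)), hδ₀U⟩, ?_, ?_, ?_⟩
  · -- `γ ∼_{st} γ₂`: conjugate in `GL₃(L ⊗ L⁺_v)`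
    obtain ⟨g, hg⟩ := isStablyConj_iff.1 hst
    change IsConj (γ.val : GL (Fin 3) (LocalRing L v)) (δ₀ : GL (Fin 3) (LocalRing L v))
    exact isConj_iff.2 ⟨g, hg⟩
  · -- `γ₂ ≁ γ` in `Gqs L v`
    intro hc
    obtain ⟨t, ht⟩ := isConj_iff.1 hc
    have htU : (t.val : GL (Fin 3) (LocalRing L v)) ∈ unitaryGroup (conjLocal L (IsCMField.complexConj L) v) (cmLocalForm L 3 v) := by
      rw [← hUU]; exact t.2
    exact hnc (isConj_iff.2 ⟨⟨t.val, htU⟩, Subtype.ext (congrArg Subtype.val ht)⟩)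
  · -- every `γ′ ∼_{st} γ` is conjugate to `γ` or to `γ₂`
    intro γ' h'
    have hγ'U : γ'.val ∈ unitaryGroup (conjLocal L (IsCMField.complexConj L) v) (cmLocalForm L 3 v) := by rw [← hUU]; exact γ'.2
    have h₁ : IsConj (γ.val : GL (Fin 3) (LocalRing L v)) γ'.val := h'
    obtain ⟨g, hg⟩ := isConj_iff.1 h₁
    rcases hall ⟨γ'.val, hγ'U⟩ (isStablyConj_iff.2 ⟨g, hg⟩) with hc | hc
    · left
      obtain ⟨t, ht⟩ := isConj_iff.1 hc
      have htU : (t : GL (Fin 3) (LocalRing L v)) ∈ unitaryGroupOfForm (conjLocal L (IsCMField.complexConj L) v) (cmLocalForm L 3 v) := by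
        rw [hUU]; exact t.2
      exact isConj_iff.2 ⟨⟨(t : GL (Fin 3) (LocalRing L v)), htU⟩, Subtype.ext (congrArg Subtype.val ht)⟩
    · right
      obtain ⟨t, ht⟩ := isConj_iff.1 hc
      have htU : (t : GL (Fin 3) (LocalRing L v)) ∈ unitaryGroupOfForm (conjLocal L (IsCMField.complexConj L) v) (cmLocalForm L 3 v) := by
        rw [hUU]; exact t.2
      exact isConj_iff.2 ⟨⟨(t : GL (Fin 3) (LocalRing L v)), htU⟩, Subtype.ext (congrArg Subtype.val ht)⟩

end TypeTwo

end Summit.HodgeConjecture.HodgeConjecture.R90.S4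

end
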